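import Mathlib.LinearAlgebra.Matrix.PosDef
import Mathlib.Analysis.Distribution.AEEqOfIntegralContDiff
import Literature.Analysis.Distribution.DivFormRegularity
import Literature.Geometry.Lorentzian.WeakSolutionChart
import Literature.Geometry.Lorentzian.ChartPieceInequalities
import Literature.Geometry.Lorentzian.VolumePositivity
import Literature.Geometry.Lorentzian.AFLinearWeakExistence
import HarnessLib

/-!
# Regularity of distributional solutions of `Δ_h u − f u = g` and smooth solutions in the
# energy space (Schoen–Yau 1979, Lemma 3.2: "a unique smooth solution")

Schoen–Yau, Comm. Math. Phys. 65 (1979), proof of Lemma 3.2 (p. 65): the solutions of the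
Dirichlet problems (3.4) are *smooth* by "standard linear elliptic theory [18, p. 262]"
(Morrey), and the limit `v` is a smooth solution of (3.2) on `N` with the `L⁶` bound (3.5). In
this tree the energy-space solution is `exists_veryWeakSolution_of_sobolev`
(`AFLinearWeakExistence.lean`): `u ∈ L⁶` with `∫ u (Δ_h ζ − f ζ) dV = ∫ g ζ dV` for
`ζ ∈ C²_c`. This file upgrades it to a smooth classical solution, **granted the named fact
`Literature.Analysis.Distribution.Folland1995_cor634`** (Folland 1995, Cor. (6.34): elliptic
operators with smooth coefficients are hypoelliptic), which enters as an explicit hypothesis: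

* `posDef_chartGramMatrix`, `divFormCoeff_chart_pos`, `contDiffOn_sqrt_det_chartGramMatrix`,
  `contDiffOn_inv_chartGramMatrix_apply` — the coordinate coefficients `aᵢⱼ = √g (G⁻¹)ⱼᵢ` of
  `√g Δ_h` are smooth and uniformly... pointwise positive definite on the chart target;
* `locallyIntegrableOn_comp_extChartAt_symm`, `ae_comp_extChartAt_of_ae_target` — local
  integrability and null sets pass between the manifold and the chart
  (`φ_*(μ_h|source) = √g · vol|target`, `map_extChartAt_restrict_riemannianMeasure`);
* `exists_contMDiffOn_ae_eq_of_veryWeak` — **interior regularity on the manifold**: a measurable,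
  locally integrable distributional solution (smooth `f, g`) agrees a.e., near every point, with
  a `C^∞` function (the equation read in a chart,
  `integral_comp_extChartAt_symm_divForm_of_veryWeak`, and the Euclidean wrapper
  `exists_contDiffOn_ae_eq_of_divForm_weak` of (6.34));
* `exists_contMDiff_ae_eq_of_forall_exists_nhds` — patching of local smooth representatives
  (two continuous representatives agree on overlaps since `μ_h` charges open sets);
* `dalembertian_sub_mul_eq_of_veryWeak` — a *smooth* distributional solution is a classical one
  (Green's identity twice, `GreenIdentityCompactSupport.lean`, and the fundamental lemma of the
  calculus of variations on manifolds, Mathlib's `ae_eq_zero_of_integral_contMDiff_smul_eq_zero`);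
* `exists_smooth_solution_of_sobolev` — **Lemma 3.2, existence of a smooth solution with the
  bound (3.5), granted (6.34)**: on a Riemannian `3`-manifold with the Sobolev inequality
  (Lemma 3.1), for smooth `f, g` with `|f|^{3/2}, |g|^{6/5}` integrable and
  `θ = c₁ ‖f₋‖_{3/2} < 1`, there is `v ∈ C^∞(X) ∩ L⁶` with `Δ_h v − f v = g` and
  `‖v‖₆ ≤ c₁ ‖g‖_{6/5} / (1 − θ)`.

What remains of Lemma 3.2 as printed: the decay `v = O(1/r)` and the expansion
`v = A/r + ω` ((3.6)–(3.20)) on the asymptotically flat end; uniqueness among `O(1/r)` solutions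
is `AFEnd.eq_of_dalembertian_sub_mul_eq` (`AFLinearUniqueness.lean`). All results are proved; no
definitions, no named facts (Folland's corollary is a hypothesis).

## References

* R. Schoen, S.-T. Yau, *On the proof of the positive mass conjecture in general relativity*,
  Comm. Math. Phys. 65 (1979) 45–76, Lemma 3.2 and its proof, (3.2)–(3.5) (pp. 64–65).
  [SchoenYauPMT1979]
* G. B. Folland, *Introduction to Partial Differential Equations*, 2nd ed. (1995), Cor. (6.34).
  [Folland2020]
* I. Chavel, *Riemannian Geometry: A Modern Introduction*, 2nd ed., CUP 2006, §III.3. [Chavel2006]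
-/

noncomputable section

open Bundle Set Function Filter Manifold MeasureTheory Measure TopologicalSpace Finset
open scoped Manifold ContDiff Topology Matrix ENNReal

namespace Literature.Geometry.Lorentzian

open PseudoRiemannianMetric

/-! ### From the distributional equation to a smooth classical solution -/

section Assembly

variable {m : ℕ} {N : Type*} [TopologicalSpace N] [ChartedSpace (EuclideanSpace ℝ (Fin m)) N]
  [IsManifold (𝓡 m) ∞ N] [T2Space N] [LocallyCompactSpace N]
  [MeasurableSpace N] [BorelSpace N]
  (h : ContMDiffRiemannianMetric (𝓡 m) ∞ (EuclideanSpace ℝ (Fin m)) (TangentSpace (𝓡 m) : N → Type _))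

/-! #### The chart Gram matrix: regularity and positivity -/

omit [T2Space N] [LocallyCompactSpace N] [MeasurableSpace N] [BorelSpace N] in
/-- The entries of the chart Gram matrix are smooth on the chart target. [folklore] -/
theorem contDiffOn_chartGramMatrix_apply (x : N) (i j : Fin m) :
    ContDiffOn ℝ ∞ (fun y ↦ chartGramMatrix h x y i j) (extChartAt (𝓡 m) x).target :=
  (contDiffOn_gram_comp_extChartAt_symm (EuclideanSpace.basisFun (Fin m) ℝ).toBasis
    (ofRiemannian h) i j).congr
    (fun _ hy ↦ chartGramMatrix_apply_eq_val_localFrame h x hy i j)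

omit [T2Space N] [LocallyCompactSpace N] [MeasurableSpace N] [BorelSpace N] in
/-- The density `√det(h_{ij})` is smooth on the chart target. [folklore] -/
theorem contDiffOn_sqrt_det_chartGramMatrix (x : N) :
    ContDiffOn ℝ ∞ (fun y ↦ Real.sqrt (chartGramMatrix h x y).det) (extChartAt (𝓡 m) x).target := by
  have hT : IsOpen (extChartAt (𝓡 m) x).target := isOpen_extChartAt_target x
  have hdet : ContDiffOn ℝ ∞ (fun y ↦ (chartGramMatrix h x y).det) (extChartAt (𝓡 m) x).target := by
    intro y hy
    show ContDiffWithinAt ℝ ∞ (fun y ↦ (chartGramMatrix h x y).det) (extChartAt (𝓡 m) x).target y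
    have h1 := contMDiffAt_matrix_det (I := 𝓘(ℝ, EuclideanSpace ℝ (Fin m))) (k := ∞)
      (A := fun y ↦ chartGramMatrix h x y) (x₀ := y)
      (fun i j ↦ contMDiffAt_iff_contDiffAt.2
        ((contDiffOn_chartGramMatrix_apply h x i j).contDiffAt (hT.mem_nhds hy)))
    exact (contMDiffAt_iff_contDiffAt.1 h1).contDiffWithinAt
  exact hdet.sqrt fun _ hy ↦ (Real.sqrt_pos.1 (sqrt_det_chartGramMatrix_pos h x hy)).ne'

omit [T2Space N] [LocallyCompactSpace N] [MeasurableSpace N] [BorelSpace N] in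
/-- The entries of the inverse chart Gram matrix are smooth on the chart target. [folklore] -/
theorem contDiffOn_inv_chartGramMatrix_apply (x : N) (i l : Fin m) :
    ContDiffOn ℝ ∞ (fun y ↦ (chartGramMatrix h x y)⁻¹ i l) (extChartAt (𝓡 m) x).target := by
  have hT : IsOpen (extChartAt (𝓡 m) x).target := isOpen_extChartAt_target x
  intro y hy
  have h1 := contMDiffAt_matrix_inv (I := 𝓘(ℝ, EuclideanSpace ℝ (Fin m))) (k := ∞)
    (A := fun y ↦ chartGramMatrix h x y) (x₀ := y)
    (fun i j ↦ contMDiffAt_iff_contDiffAt.2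
      ((contDiffOn_chartGramMatrix_apply h x i j).contDiffAt (hT.mem_nhds hy)))
    (Real.sqrt_pos.1 (sqrt_det_chartGramMatrix_pos h x hy)).ne' i l
  exact (contMDiffAt_iff_contDiffAt.1 h1).contDiffWithinAt

/-- The quadratic form of a real matrix: `x ⬝ᵥ (A *ᵥ x) = ∑ᵢⱼ Aᵢⱼ xᵢ xⱼ`. [folklore] -/
private theorem dotProduct_mulVec_eq_sum₂ {n : ℕ} (A : Matrix (Fin n) (Fin n) ℝ) (x : Fin n → ℝ) :
    x ⬝ᵥ (A *ᵥ x) = ∑ i, ∑ j, A i j * x i * x j := by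
  simp only [dotProduct, Matrix.mulVec, Finset.mul_sum]
  refine Finset.sum_congr rfl fun i _ ↦ Finset.sum_congr rfl fun j _ ↦ ?_
  ring

omit [T2Space N] [LocallyCompactSpace N] [MeasurableSpace N] [BorelSpace N] in
/-- **The chart Gram matrix is positive definite** on the chart target (it is the Gram matrix of
the coordinate frame under a Riemannian metric). [folklore] -/
theorem posDef_chartGramMatrix (x : N) {y : EuclideanSpace ℝ (Fin m)}
    (hy : y ∈ (extChartAt (𝓡 m) x).target) : (chartGramMatrix h x y).PosDef := by
  classical
  set b : Module.Basis (Fin m) ℝ (EuclideanSpace ℝ (Fin m)) := (EuclideanSpace.basisFun (Fin m) ℝ).toBasis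
  have hys : (extChartAt (𝓡 m) x).symm y ∈ (chartAt (EuclideanSpace ℝ (Fin m)) x).source := by
    rw [← extChartAt_source (𝓡 m)]; exact (extChartAt (𝓡 m) x).map_target hy
  have hpe : (extChartAt (𝓡 m) x).symm y ∈
      (trivializationAt (EuclideanSpace ℝ (Fin m)) (TangentSpace (𝓡 m)) x).baseSet := by
    simpa using hys
  set β := (trivializationAt (EuclideanSpace ℝ (Fin m)) (TangentSpace (𝓡 m)) x).basisAt b hpe
    with hβ
  have hFrβ : ∀ i, (trivializationAt (EuclideanSpace ℝ (Fin m)) (TangentSpace (𝓡 m)) x).localFrame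
      b i ((extChartAt (𝓡 m) x).symm y) = β i := fun i ↦
    Trivialization.localFrame_apply_of_mem_baseSet _ b hpe
  have hG : ∀ i j, chartGramMatrix h x y i j = (ofRiemannian h).val ((extChartAt (𝓡 m) x).symm y)
      (β i) (β j) := fun i j ↦ by
    rw [chartGramMatrix_apply_eq_val_localFrame h x hy i j, hFrβ, hFrβ]
  refine Matrix.PosDef.of_dotProduct_mulVec_pos ?_ fun v hv ↦ ?_
  · ext i j
    simp only [Matrix.conjTranspose_apply, star_trivial]
    exact chartGramMatrix_apply_comm h x y j i
  · have hq : star v ⬝ᵥ (chartGramMatrix h x y *ᵥ v) =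
        (ofRiemannian h).val ((extChartAt (𝓡 m) x).symm y) (∑ i, v i • β i) (∑ j, v j • β j) := by
      rw [star_trivial, dotProduct_mulVec_eq_sum₂]
      simp only [hG, _root_.map_sum, map_smul, _root_.sum_apply, _root_.smul_apply, smul_eq_mul,
        Finset.mul_sum]
      refine Finset.sum_congr rfl fun i _ ↦ Finset.sum_congr rfl fun j _ ↦ ?_
      rw [(ofRiemannian h).symm _ (β j) (β i)]
      ring
    rw [hq]
    refine isRiemannian_ofRiemannian h _ _ fun h0 ↦ hv ?_
    funext i
    exact Fintype.linearIndependent_iff.1 β.linearIndependent v h0 i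

omit [T2Space N] [LocallyCompactSpace N] [MeasurableSpace N] [BorelSpace N] in
/-- **Ellipticity of the coordinate coefficients `aᵢⱼ = √g (G⁻¹)ⱼᵢ`**: positive definiteness of
their quadratic form on the chart target. [folklore] -/
theorem divFormCoeff_chart_pos (x : N) {y : EuclideanSpace ℝ (Fin m)}
    (hy : y ∈ (extChartAt (𝓡 m) x).target) (v : Fin m → ℝ) (hv : v ≠ 0) :
    0 < ∑ i, ∑ j, (Real.sqrt (chartGramMatrix h x y).det * (chartGramMatrix h x y)⁻¹ j i) *
      (v i * v j) := by
  have hA : ((chartGramMatrix h x y)⁻¹).PosDef := (posDef_chartGramMatrix h x hy).inv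
  have hpos := hA.dotProduct_mulVec_pos hv
  rw [star_trivial, dotProduct_mulVec_eq_sum₂] at hpos
  have hρ := sqrt_det_chartGramMatrix_pos h x hy
  have hsymm : ∀ i j, (chartGramMatrix h x y)⁻¹ j i = (chartGramMatrix h x y)⁻¹ i j := by
    have hs : (chartGramMatrix h x y).IsSymm :=
      Matrix.IsSymm.ext fun i j ↦ chartGramMatrix_apply_comm h x y j i
    intro i j
    exact hs.inv.apply i j
  have heq : ∑ i, ∑ j, (Real.sqrt (chartGramMatrix h x y).det * (chartGramMatrix h x y)⁻¹ j i) *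
      (v i * v j) = Real.sqrt (chartGramMatrix h x y).det *
        ∑ i, ∑ j, (chartGramMatrix h x y)⁻¹ i j * v i * v j := by
    rw [Finset.mul_sum]
    refine Finset.sum_congr rfl fun i _ ↦ ?_
    rw [Finset.mul_sum]
    refine Finset.sum_congr rfl fun j _ ↦ ?_
    rw [hsymm i j]
    ring
  rw [heq]
  exact mul_pos hρ hpos

variable [(ofRiemannian h).HasLeviCivita]

/-! #### Local integrability and null sets in a chart -/

omit [(ofRiemannian h).HasLeviCivita] in
/-- The chart representative of a locally integrable function is locally integrable on the chart
target (the Riemannian density is bounded below on compact parts of the target). [folklore] -/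
theorem locallyIntegrableOn_comp_extChartAt_symm (x : N) {u : N → ℝ} (hum : Measurable u)
    (hu : LocallyIntegrable u (riemannianMeasure h)) :
    LocallyIntegrableOn (u ∘ (extChartAt (𝓡 m) x).symm) (extChartAt (𝓡 m) x).target
      (volume : Measure (EuclideanSpace ℝ (Fin m))) := by
  rw [locallyIntegrableOn_iff (isOpen_extChartAt_target x).isLocallyClosed]
  intro K hKT hK
  obtain ⟨c, hc, hle⟩ := exists_setLIntegral_comp_symm_le h x hK hKT
  refine ⟨(hum.comp_aemeasurable ((aemeasurable_extChartAt_symm_restrict x).mono_measure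
    (Measure.restrict_mono hKT le_rfl))).aestronglyMeasurable, ?_⟩
  have h1 := hle (fun p ↦ ‖u p‖ₑ) hum.enorm K Subset.rfl hK.measurableSet
  have himg : IsCompact ((extChartAt (𝓡 m) x).symm '' K) :=
    hK.image_of_continuousOn ((continuousOn_extChartAt_symm x).mono hKT)
  have hsub : (extChartAt (𝓡 m) x).source ∩ extChartAt (𝓡 m) x ⁻¹' K ⊆
      (extChartAt (𝓡 m) x).symm '' K := by
    rintro p ⟨hp, hpK⟩
    exact ⟨extChartAt (𝓡 m) x p, hpK, (extChartAt (𝓡 m) x).left_inv hp⟩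
  have h2 : ∫⁻ p in (extChartAt (𝓡 m) x).source ∩ extChartAt (𝓡 m) x ⁻¹' K, ‖u p‖ₑ
      ∂riemannianMeasure h < ⊤ :=
    (lintegral_mono_set hsub).trans_lt (hu.integrableOn_isCompact himg).2
  show ∫⁻ y in K, ‖(u ∘ (extChartAt (𝓡 m) x).symm) y‖ₑ < ⊤
  exact h1.trans_lt (ENNReal.mul_lt_top hc.lt_top h2)

omit [(ofRiemannian h).HasLeviCivita] in
/-- **Null sets transfer from the chart target to the manifold**: a property holding Lebesgue-a.e.
on a subset `U` of the chart target holds `μ_h`-a.e. on its preimage in the chart domain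
(`φ_*(μ_h|source) = √g · vol|target ≪ vol`). [folklore] -/
theorem ae_comp_extChartAt_of_ae_target (x : N) {U : Set (EuclideanSpace ℝ (Fin m))}
    {P : EuclideanSpace ℝ (Fin m) → Prop}
    (hae : ∀ᵐ y ∂(volume : Measure (EuclideanSpace ℝ (Fin m))), y ∈ U → P y) :
    ∀ᵐ p ∂riemannianMeasure h, p ∈ (extChartAt (𝓡 m) x).source →
      extChartAt (𝓡 m) x p ∈ U → P (extChartAt (𝓡 m) x p) := by
  have hs : MeasurableSet (extChartAt (𝓡 m) x).source := (isOpen_extChartAt_source x).measurableSet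
  have h1 : ∀ᵐ y ∂((volume : Measure (EuclideanSpace ℝ (Fin m))).restrict
      (extChartAt (𝓡 m) x).target), y ∈ U → P y := ae_restrict_of_ae hae
  have h2 : ∀ᵐ y ∂(((volume : Measure (EuclideanSpace ℝ (Fin m))).restrict
      (extChartAt (𝓡 m) x).target).withDensity
        (fun y ↦ ENNReal.ofReal (Real.sqrt (chartGramMatrix h x y).det))), y ∈ U → P y :=
    (withDensity_absolutelyContinuous _ _).ae_le h1
  rw [← map_extChartAt_restrict_riemannianMeasure h x] at h2
  have h3 := ae_of_ae_map (aemeasurable_extChartAt_restrict x (riemannianMeasure h)) h2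
  rw [ae_restrict_iff' hs] at h3
  exact h3

/-! #### Local smooth representatives -/

/-- **Interior regularity on the manifold, locally** (granted `Folland1995_cor634`): if `u` is
measurable and locally integrable, `f, g ∈ C^∞(N)`, and `∫ u (Δ_h ζ − f ζ) dμ_h = ∫ g ζ dμ_h` for
all `ζ ∈ C²_c(N)`, then every point has an open neighbourhood on which `u` agrees a.e. with a
`C^∞` function (read the equation in a chart, `integral_comp_extChartAt_symm_divForm_of_veryWeak`,
apply `exists_contDiffOn_ae_eq_of_divForm_weak`, and pull the smooth representative back).
[cite: Folland2020, Cor. (6.34)] -/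
theorem exists_contMDiffOn_ae_eq_of_veryWeak [Nontrivial (EuclideanSpace ℝ (Fin m))]
    (hF : Literature.Analysis.Distribution.Folland1995_cor634)
    {u : N → ℝ} (hum : Measurable u) (hu : LocallyIntegrable u (riemannianMeasure h))
    {f g : N → ℝ} (hf : ContMDiff (𝓡 m) 𝓘(ℝ, ℝ) ∞ f) (hg : ContMDiff (𝓡 m) 𝓘(ℝ, ℝ) ∞ g)
    (hweak : ∀ ζ : N → ℝ, ContMDiff (𝓡 m) 𝓘(ℝ, ℝ) 2 ζ → HasCompactSupport ζ →
      ∫ p, u p * ((ofRiemannian h).dalembertian ζ p - f p * ζ p) ∂riemannianMeasure h =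
        ∫ p, g p * ζ p ∂riemannianMeasure h) (x : N) :
    ∃ V : Set N, IsOpen V ∧ x ∈ V ∧ ∃ w : N → ℝ, ContMDiffOn (𝓡 m) 𝓘(ℝ, ℝ) ∞ w V ∧
      ∀ᵐ p ∂riemannianMeasure h, p ∈ V → u p = w p := by
  classical
  set b : Module.Basis (Fin m) ℝ (EuclideanSpace ℝ (Fin m)) := (EuclideanSpace.basisFun (Fin m) ℝ).toBasis
    with hb_def
  have hT : IsOpen (extChartAt (𝓡 m) x).target := isOpen_extChartAt_target x
  have hρ := contDiffOn_sqrt_det_chartGramMatrix h x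
  -- the Euclidean regularity theorem in the chart at `x`
  obtain ⟨U, hUo, hxU, hUT, w, hw, hae⟩ :=
    Literature.Analysis.Distribution.exists_contDiffOn_ae_eq_of_divForm_weak
      (volume : Measure (EuclideanSpace ℝ (Fin m))) b hF hT
      (a := fun i j z ↦ Real.sqrt (chartGramMatrix h x z).det * (chartGramMatrix h x z)⁻¹ j i)
      (fun i j ↦ hρ.mul (contDiffOn_inv_chartGramMatrix_apply h x j i))
      (fun y hy v hv ↦ divFormCoeff_chart_pos h x hy v hv)
      (c := fun y ↦ Real.sqrt (chartGramMatrix h x y).det * f ((extChartAt (𝓡 m) x).symm y))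
      (hρ.mul (contDiffOn_comp_extChartAt_symm hf))
      (G := fun y ↦ Real.sqrt (chartGramMatrix h x y).det * g ((extChartAt (𝓡 m) x).symm y))
      (hρ.mul (contDiffOn_comp_extChartAt_symm hg))
      (locallyIntegrableOn_comp_extChartAt_symm h x hum hu)
      (fun ψ hψ hψc hψT ↦ integral_comp_extChartAt_symm_divForm_of_veryWeak h x hum hf.continuous
        hg.continuous hweak hψ hψc hψT)
      ((extChartAt (𝓡 m) x).map_source (mem_extChartAt_source x))
  -- pull back
  obtain ⟨V, hV⟩ : ∃ V : Set N, V = (extChartAt (𝓡 m) x).source ∩ extChartAt (𝓡 m) x ⁻¹' U :=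
    ⟨_, rfl⟩
  have hVo : IsOpen V := by
    rw [hV]; exact (continuousOn_extChartAt x).isOpen_inter_preimage (isOpen_extChartAt_source x) hUo
  have hxV : x ∈ V := by rw [hV]; exact ⟨mem_extChartAt_source x, hxU⟩
  refine ⟨V, hVo, hxV, w ∘ extChartAt (𝓡 m) x, ?_, ?_⟩
  · have hwU : ContMDiffOn 𝓘(ℝ, EuclideanSpace ℝ (Fin m)) 𝓘(ℝ, ℝ) ∞ w U :=
      contMDiffOn_iff_contDiffOn.2 hw
    have hφ0 : ContMDiffOn (𝓡 m) 𝓘(ℝ, EuclideanSpace ℝ (Fin m)) ∞ (extChartAt (𝓡 m) x)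
        (extChartAt (𝓡 m) x).source := by
      rw [extChartAt_source]
      exact contMDiffOn_extChartAt
    have hφ : ContMDiffOn (𝓡 m) 𝓘(ℝ, EuclideanSpace ℝ (Fin m)) ∞ (extChartAt (𝓡 m) x) V := by
      rw [hV]
      exact hφ0.mono inter_subset_left
    exact hwU.comp hφ (fun p hp ↦ by rw [hV] at hp; exact hp.2)
  · have := ae_comp_extChartAt_of_ae_target h x (P := fun y ↦ u ((extChartAt (𝓡 m) x).symm y) = w y)
      hae
    filter_upwards [this] with p hp hpV
    rw [hV] at hpV
    have h1 := hp hpV.1 hpV.2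
    rw [(extChartAt (𝓡 m) x).left_inv hpV.1] at h1
    exact h1

/-! #### Patching local smooth representatives -/

omit [IsManifold (𝓡 m) ∞ N] [T2Space N] [LocallyCompactSpace N] [(ofRiemannian h).HasLeviCivita] in
/-- **Patching**: if a function agrees, near every point, a.e. with a smooth function, then it
agrees a.e. with a global smooth function (two continuous representatives agree on the overlap,
the Riemannian measure charging open sets). [folklore] -/
theorem exists_contMDiff_ae_eq_of_forall_exists_nhds [SigmaCompactSpace N] {μ : Measure N}
    [μ.IsOpenPosMeasure] {u : N → ℝ}
    (hloc : ∀ x : N, ∃ V : Set N, IsOpen V ∧ x ∈ V ∧ ∃ w : N → ℝ, ContMDiffOn (𝓡 m) 𝓘(ℝ, ℝ) ∞ w V ∧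
      ∀ᵐ p ∂μ, p ∈ V → u p = w p) :
    ∃ v : N → ℝ, ContMDiff (𝓡 m) 𝓘(ℝ, ℝ) ∞ v ∧ ∀ᵐ p ∂μ, u p = v p := by
  haveI := ChartedSpace.secondCountable_of_sigmaCompact (EuclideanSpace ℝ (Fin m)) N
  choose V hVo hxV w hw hae using hloc
  -- two representatives agree on the overlap of their domains
  have hagree : ∀ x z, EqOn (w x) (w z) (V x ∩ V z) := by
    intro x z
    refine Measure.eqOn_open_of_ae_eq (μ := μ) ?_ ((hVo x).inter (hVo z))
      ((hw x).continuousOn.mono inter_subset_left) ((hw z).continuousOn.mono inter_subset_right)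
    rw [Filter.EventuallyEq, ae_restrict_iff' ((hVo x).inter (hVo z)).measurableSet]
    filter_upwards [hae x, hae z] with p hpx hpz hp
    rw [← hpx hp.1, ← hpz hp.2]
  refine ⟨fun p ↦ w p p, ?_, ?_⟩
  · intro x
    have hev : (fun p ↦ w p p) =ᶠ[𝓝 x] w x := by
      filter_upwards [(hVo x).mem_nhds (hxV x)] with p hp
      exact hagree p x ⟨hxV p, hp⟩
    exact (((hw x).contMDiffAt ((hVo x).mem_nhds (hxV x))).congr_of_eventuallyEq hev)
  · obtain ⟨t, htc, ht⟩ := TopologicalSpace.countable_cover_nhds (f := V)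
      (fun x ↦ (hVo x).mem_nhds (hxV x))
    have hall : ∀ᵐ p ∂μ, ∀ x ∈ t, p ∈ V x → u p = w x p :=
      (ae_ball_iff htc).2 fun x _ ↦ hae x
    filter_upwards [hall] with p hp
    have hpt : p ∈ ⋃ x ∈ t, V x := by rw [ht]; exact mem_univ p
    obtain ⟨x, hxt, hpx⟩ := mem_iUnion₂.1 hpt
    rw [hp x hxt hpx]
    exact hagree x p ⟨hpx, hxV p⟩

/-! #### From the distributional to the classical equation for smooth functions -/

/-- **A smooth distributional solution is a classical solution**: if `v ∈ C^∞(N)`, `f, g`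
continuous, and `∫ v (Δ_h ζ − f ζ) dμ_h = ∫ g ζ dμ_h` for all `ζ ∈ C^∞_c(N)`, then
`Δ_h v − f v = g` everywhere (Green's identity twice to move `Δ_h` onto `v`, then the fundamental
lemma of the calculus of variations on the manifold and continuity). [folklore] -/
theorem dalembertian_sub_mul_eq_of_veryWeak [SigmaCompactSpace N] {v : N → ℝ} (hv : ContMDiff (𝓡 m) 𝓘(ℝ, ℝ) ∞ v)
    {f g : N → ℝ} (hf : Continuous f) (hg : Continuous g)
    (hweak : ∀ ζ : N → ℝ, ContMDiff (𝓡 m) 𝓘(ℝ, ℝ) ∞ ζ → HasCompactSupport ζ →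
      ∫ p, v p * ((ofRiemannian h).dalembertian ζ p - f p * ζ p) ∂riemannianMeasure h =
        ∫ p, g p * ζ p ∂riemannianMeasure h) (p : N) :
    (ofRiemannian h).dalembertian v p - f p * v p = g p := by
  set μ : Measure N := riemannianMeasure h with hμ
  haveI : IsFiniteMeasureOnCompacts μ :=
    ⟨fun K hK ↦ riemannianVolume_lt_top_of_isCompact_holds h le_rfl hK⟩
  haveI : μ.IsOpenPosMeasure := isOpenPosMeasure_riemannianMeasure h
  have hv1 : ContMDiff (𝓡 m) 𝓘(ℝ, ℝ) 1 v := by exact_mod_cast contMDiff_infty.1 hv 1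
  have hv2 : ContMDiff (𝓡 m) 𝓘(ℝ, ℝ) 2 v := by exact_mod_cast contMDiff_infty.1 hv 2
  have hΔv : Continuous ((ofRiemannian h).dalembertian v) := continuous_dalembertian _ hv2
  obtain ⟨F, hFdef⟩ : ∃ F : N → ℝ, F = fun q ↦ (ofRiemannian h).dalembertian v q - f q * v q - g q :=
    ⟨_, rfl⟩
  have hFc : Continuous F := by
    rw [hFdef]; exact (hΔv.sub (hf.mul hv.continuous)).sub hg
  -- `∫ F ζ dμ = 0` for every smooth compactly supported `ζ`
  have hzero : ∀ ζ : N → ℝ, ContMDiff (𝓡 m) 𝓘(ℝ, ℝ) ∞ ζ → HasCompactSupport ζ → ∫ q, ζ q • F q ∂μ = 0 := by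
    intro ζ hζ hζc
    have hζ1 : ContMDiff (𝓡 m) 𝓘(ℝ, ℝ) 1 ζ := by exact_mod_cast contMDiff_infty.1 hζ 1
    have hζ2 : ContMDiff (𝓡 m) 𝓘(ℝ, ℝ) 2 ζ := by exact_mod_cast contMDiff_infty.1 hζ 2
    have hζcont : Continuous ζ := hζ.continuous
    -- Green twice: `∫ v Δζ = ∫ ζ Δv`
    have hG1 := integral_mul_dalembertian_eq_neg_integral_innerDual_of_hasCompactSupport_right h hv1
      hζ2 hζc
    have hG2 := integral_mul_dalembertian_eq_neg_integral_innerDual_of_hasCompactSupport h hζ1 hζc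
      hv2
    have hsymm : ∫ q, (ofRiemannian h).innerDual q (mvfderiv (𝓡 m) v q).toLinearMap
        (mvfderiv (𝓡 m) ζ q).toLinearMap ∂μ = ∫ q, (ofRiemannian h).innerDual q
        (mvfderiv (𝓡 m) ζ q).toLinearMap (mvfderiv (𝓡 m) v q).toLinearMap ∂μ :=
      integral_congr_ae (Eventually.of_forall fun q ↦ (ofRiemannian h).innerDual_comm q _ _)
    have hswap : ∫ q, v q * (ofRiemannian h).dalembertian ζ q ∂μ =
        ∫ q, ζ q * (ofRiemannian h).dalembertian v q ∂μ := by
      rw [hG1, hG2, hsymm]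
    -- integrability of the pieces
    have hΔζ : Continuous ((ofRiemannian h).dalembertian ζ) := continuous_dalembertian _ hζ2
    have hi1 : Integrable (fun q ↦ v q * (ofRiemannian h).dalembertian ζ q) μ := by
      have hcs : HasCompactSupport (fun q ↦ v q * (ofRiemannian h).dalembertian ζ q) :=
        HasCompactSupport.intro hζc fun q hq ↦ by
          rw [dalembertian_eq_zero_of_notMem_tsupport _ hq, mul_zero]
      exact (hv.continuous.mul hΔζ).integrable_of_hasCompactSupport hcs
    have hi2 : Integrable (fun q ↦ v q * (f q * ζ q)) μ := by
      have hcs : HasCompactSupport (fun q ↦ v q * (f q * ζ q)) := (hζc.mul_left).mul_left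
      exact (hv.continuous.mul (hf.mul hζcont)).integrable_of_hasCompactSupport hcs
    have hi3 : Integrable (fun q ↦ ζ q * (ofRiemannian h).dalembertian v q) μ := by
      have hcs : HasCompactSupport (fun q ↦ ζ q * (ofRiemannian h).dalembertian v q) := hζc.mul_right
      exact (hζcont.mul hΔv).integrable_of_hasCompactSupport hcs
    have hi4 : Integrable (fun q ↦ g q * ζ q) μ := by
      have hcs : HasCompactSupport (fun q ↦ g q * ζ q) := hζc.mul_left
      exact (hg.mul hζcont).integrable_of_hasCompactSupport hcs
    have hW := hweak ζ hζ hζc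
    have hsplit : ∫ q, v q * ((ofRiemannian h).dalembertian ζ q - f q * ζ q) ∂μ =
        ∫ q, v q * (ofRiemannian h).dalembertian ζ q ∂μ - ∫ q, v q * (f q * ζ q) ∂μ := by
      rw [← integral_sub hi1 hi2]
      exact integral_congr_ae (Eventually.of_forall fun q ↦ by ring)
    rw [hsplit, hswap] at hW
    have hi5 : Integrable (fun q ↦ ζ q * (ofRiemannian h).dalembertian v q - v q * (f q * ζ q)) μ :=
      hi3.sub hi2
    have hFi : ∫ q, ζ q • F q ∂μ = ∫ q, ζ q * (ofRiemannian h).dalembertian v q ∂μ -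
        ∫ q, v q * (f q * ζ q) ∂μ - ∫ q, g q * ζ q ∂μ := by
      rw [← integral_sub hi3 hi2, ← integral_sub hi5 hi4]
      refine integral_congr_ae (Eventually.of_forall fun q ↦ ?_)
      simp only [hFdef, smul_eq_mul]
      ring
    rw [hFi, hW]
    ring
  -- the fundamental lemma and continuity
  have hae := ae_eq_zero_of_integral_contMDiff_smul_eq_zero (𝓡 m) (μ := μ)
    (hFc.locallyIntegrable) hzero
  have hF0 : F = fun _ ↦ 0 := (Continuous.ae_eq_iff_eq μ hFc continuous_const).1 hae
  have := congr_fun hF0 p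
  simp only [hFdef] at this
  linarith

end Assembly

/-! ### Smooth solutions in the energy space on a 3-manifold with a Sobolev inequality -/

section Sobolev

variable {X : Type} [TopologicalSpace X] [ChartedSpace E3 X] [IsManifold (𝓡 3) ∞ X]
  [T2Space X] [LocallyCompactSpace X] [SigmaCompactSpace X] [MeasurableSpace X] [BorelSpace X]
  (D : InitialDataSet (𝓡 3) X) [D.metric.HasLeviCivita]

/-- **Schoen–Yau 1979, Lemma 3.2 — existence of a smooth solution with the `L⁶` bound (3.5),
granted Folland's Cor. (6.34).** Let `(X, h)` be a Riemannian `3`-manifold satisfying the Sobolev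
inequality `(∫ |ζ|⁶ dV)^{1/3} ≤ c₁ ∫ h⁻¹(dζ, dζ) dV` for `ζ ∈ C¹_c(X)` (Lemma 3.1,
`AFEnd.sobolev_inequality`), `f, g ∈ C^∞(X)` with `|f|^{3/2}`, `|g|^{6/5}` integrable and
`θ = c₁ (∫ f₋^{3/2})^{2/3} < 1`. Then there is `v ∈ C^∞(X)` with `|v|⁶` integrable,
`∫ |v|⁶ dV ≤ (c₁ ‖g‖_{6/5} / (1 − θ))⁶` and `Δ_h v − f v = g` on `X` — the energy-space solution of
`exists_veryWeakSolution_of_sobolev` is smooth (`exists_contMDiffOn_ae_eq_of_veryWeak`,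
`exists_contMDiff_ae_eq_of_forall_exists_nhds`) and solves the equation classically
(`dalembertian_sub_mul_eq_of_veryWeak`). The elliptic regularity theorem enters as the hypothesis
`hF : Folland1995_cor634`. [cite: SchoenYauPMT1979, Lemma 3.2 (p. 64) and its proof, (3.5) (p. 65)] -/
theorem exists_smooth_solution_of_sobolev (hF : Literature.Analysis.Distribution.Folland1995_cor634)
    {c₁ : ℝ} (hc₁ : 0 ≤ c₁)
    (hS : ∀ ζ : X → ℝ, ContMDiff (𝓡 3) 𝓘(ℝ, ℝ) 1 ζ → HasCompactSupport ζ →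
      (∫ x, |ζ x| ^ 6 ∂riemannianMeasure D.h) ^ (1 / 3 : ℝ) ≤
        c₁ * ∫ x, D.metric.innerDual x (mvfderiv (𝓡 3) ζ x).toLinearMap
          (mvfderiv (𝓡 3) ζ x).toLinearMap ∂riemannianMeasure D.h)
    {f g : X → ℝ} (hf : ContMDiff (𝓡 3) 𝓘(ℝ, ℝ) ∞ f) (hg : ContMDiff (𝓡 3) 𝓘(ℝ, ℝ) ∞ g)
    (hfi : Integrable (fun x ↦ |f x| ^ (3 / 2 : ℝ)) (riemannianMeasure D.h))
    (hθ : c₁ * (∫ x, max (-f x) 0 ^ (3 / 2 : ℝ) ∂riemannianMeasure D.h) ^ (2 / 3 : ℝ) < 1)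
    (hgi : Integrable (fun x ↦ |g x| ^ (6 / 5 : ℝ)) (riemannianMeasure D.h)) :
    ∃ v : X → ℝ, ContMDiff (𝓡 3) 𝓘(ℝ, ℝ) ∞ v ∧ MemLp v 6 (riemannianMeasure D.h) ∧
      ∫ x, |v x| ^ 6 ∂riemannianMeasure D.h ≤
        (c₁ * (∫ x, |g x| ^ (6 / 5 : ℝ) ∂riemannianMeasure D.h) ^ (5 / 6 : ℝ) /
          (1 - c₁ * (∫ x, max (-f x) 0 ^ (3 / 2 : ℝ) ∂riemannianMeasure D.h) ^ (2 / 3 : ℝ))) ^ 6 ∧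
      ∀ x, D.metric.dalembertian v x - f x * v x = g x := by
  classical
  haveI : (PseudoRiemannianMetric.ofRiemannian D.h).HasLeviCivita := ‹D.metric.HasLeviCivita›
  haveI : Nontrivial E3 := Module.nontrivial_of_finrank_pos (R := ℝ)
    (by rw [finrank_euclideanSpace_fin]; norm_num)
  set μ : Measure X := riemannianMeasure D.h with hμ
  haveI : IsFiniteMeasureOnCompacts μ :=
    ⟨fun K hK ↦ riemannianVolume_lt_top_of_isCompact_holds D.h le_rfl hK⟩
  haveI : μ.IsOpenPosMeasure := isOpenPosMeasure_riemannianMeasure D.h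
  -- the energy-space solution
  obtain ⟨u, hu6, hub, huw⟩ := exists_veryWeakSolution_of_sobolev D hc₁ hS hf.continuous
    hg.continuous hfi hθ hgi
  -- a measurable representative
  set u' : X → ℝ := hu6.1.mk u with hu'
  have huu' : u =ᵐ[μ] u' := hu6.1.ae_eq_mk
  have hu'm : Measurable u' := hu6.1.stronglyMeasurable_mk.measurable
  have hu'6 : MemLp u' 6 μ := hu6.ae_eq huu'
  have hu'li : LocallyIntegrable u' μ := hu'6.locallyIntegrable (by norm_num)
  have hweak' : ∀ ζ : X → ℝ, ContMDiff (𝓡 3) 𝓘(ℝ, ℝ) 2 ζ → HasCompactSupport ζ →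
      ∫ p, u' p * ((ofRiemannian D.h).dalembertian ζ p - f p * ζ p) ∂μ = ∫ p, g p * ζ p ∂μ := by
    intro ζ hζ hζc
    rw [← huw ζ hζ hζc]
    refine integral_congr_ae ?_
    filter_upwards [huu'] with p hp
    rw [hp]
    rfl
  -- local smooth representatives and patching
  have hloc := exists_contMDiffOn_ae_eq_of_veryWeak D.h hF hu'm hu'li hf hg hweak'
  obtain ⟨v, hv, hu'v⟩ := exists_contMDiff_ae_eq_of_forall_exists_nhds (m := 3) (μ := μ) hloc
  have huv : u =ᵐ[μ] v := huu'.trans hu'v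
  refine ⟨v, hv, hu6.ae_eq huv, ?_, ?_⟩
  · have : ∫ x, |v x| ^ 6 ∂μ = ∫ x, |u x| ^ 6 ∂μ := by
      refine integral_congr_ae ?_
      filter_upwards [huv] with x hx
      rw [hx]
    rw [this]
    exact hub
  · -- the classical equation
    refine dalembertian_sub_mul_eq_of_veryWeak D.h hv hf.continuous hg.continuous
      (fun ζ hζ hζc ↦ ?_)
    have hζ2 : ContMDiff (𝓡 3) 𝓘(ℝ, ℝ) 2 ζ := by exact_mod_cast contMDiff_infty.1 hζ 2
    rw [← hweak' ζ hζ2 hζc]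
    refine integral_congr_ae ?_
    filter_upwards [hu'v] with p hp
    rw [hp]

end Sobolev

end Literature.Geometry.Lorentzian
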